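import Summits.BirchSwinnertonDyer.BirchSwinnertonDyer.Theorems.SylvesterTwoHeegnerIndexCoupledTelescopeDerivedInvariance
import Summits.BirchSwinnertonDyer.BirchSwinnertonDyer.Theorems.SylvesterTwoHeegnerIndexCoupledTelescopeCoherentGenerator
import Summits.BirchSwinnertonDyer.BirchSwinnertonDyer.Theorems.SylvesterTwoHeegnerIndexCMDataCoupledFrame
import Summits.BirchSwinnertonDyer.BirchSwinnertonDyer.Theorems.SylvesterTwoHeegnerIndexCMFlipCoherentFrame
import HarnessLib

/-!
# The COUPLED Cassels–Tate telescope, XXXVI: the LEVEL DATA of the (T-L1) class term at a general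
# square-free conductor `9p·n₀` (RESIDUE c v3, crux `UpperOffV0HSYPlus`, stmt-BirchSwinnertonDyer-19804)

The rows' class term `c_X(n₀)` (k-ty1 SPEC §5 (R0)–(R7)) is the CM-frame Kolyvagin class of the derived point
`D_l y ∈ W₀(K[9p·n₀])`, `D_l = D_{σ_{q₁}} ∘ ⋯ ∘ D_{σ_{q_r}}` along a list `l` of generators `σ_q` of the
`G_q = Gal(K[9pn₀]/K[9pn₀/q])`, `q ∣ n₀`.  This file packages, ONCE for every level (including `n₀ = 1`,
`l = []`), what the recipe and the FLIPs consume, from the global data (coupled frame of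
`exists_coupledFrame`, frame transport `κ`, the bottom embedding `emb₀ : K[9p] → K̄` with its fixer `N₀` and
a transversal `t` of `Γ_K/N₀`) and the level data (a COHERENT embedding `emb : K[9pn₀] → K̄`, its fixer `N`,
the list `l` with `⟨σ_q⟩ = G_q`, `2^M ∣ q + 1`, and the CM point `y` over `φ(τ_{Q^{(n₀)}})`):
* `commute_of_zpowers_eq_ringClassGalOver` — the `σ_q` commute (`Gal(K[m]/K)` is abelian);
* `pow_succ_eq_one_of_zpowers_eq_ringClassGalOver` — `σ_q^{q+1} = 1` (`#G_q = q + 1`);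
* `sum_pointGalHom_pow_eq_zero_of_level` — (ES1) `Σ_{i ≤ q} σ_q^i y_{n₀} = 0` at a free level ((T10));
* ★ `levelData_sylvesterTower` — all of the above along `l`, the (R5) invariance of `κ⁻¹ ι(D_l y)` under `N₀`
  modulo `2^M` ((T16)), and the LEVEL PACKAGE (`coupledFrame_levelPackage`): `N ⊴ Γ_K`, the cube roots fixed,
  admissibility of `E₉(K̄)^N` transported to `B_K = E_p ⊗ K` and `A_K = E_{3p²} ⊗ K` at the level `nl = 2^M`, and
  the two χ-components of `κ⁻¹ ι(D_l y)` in `invPoints` — i.e. the class terms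
  `c_B^{(n₀)}, c_A^{(n₀)}` are well-formed TREE TERMS at every level.
Theorems only (no definition / named fact / instance / notation); nothing asserted on 19804; no stub closed;
X12.CMAtTwo NOT proved; BSD not claimed for any curve.  Sources: [GrossLMS1991] §3 (3.3)–(3.7), §4 (4.1)–(4.3);
[McCallumLMS1991] §4 (4); [HuShuYin2019] §2 Prop. 2.4, §4.1.  `lean search 'levelData'` → nothing before this file.
-/

set_option linter.dupNamespace false -- Summits modules are `Summit.<Summit>.<Problem>…` by design
set_option autoImplicit false

noncomputable section

open scoped Classical

namespace Summit.BirchSwinnertonDyer.BirchSwinnertonDyer.Theorems.SylvesterTwoCMFlip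

open WeierstrassCurve Field NumberField IsDedekindDomain Finset
open Literature.NumberTheory.EllipticCurves Literature.NumberTheory.GaloisRepresentations
  Literature.NumberTheory.EllipticCurves.ModularForms
  Literature.NumberTheory.EllipticCurves.HuShuYin2019
  Literature.NumberTheory.EllipticCurves.KolyvaginCocycle
  Literature.NumberTheory.EllipticCurves.RingClassField
  Summit.BirchSwinnertonDyer.BirchSwinnertonDyer.Theorems.SylvesterTwoCMData
  Summit.BirchSwinnertonDyer.Rank1Residual.X11b.RingClassTower
  Summit.BirchSwinnertonDyer.Rank1Residual.X11b

variable {K : Type} [Field K] [NumberField K]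

/-- **Generators of the `G_q` commute**: two automorphisms of `K[m]` each generating some
`Gal(K[m]/K[m'])` lie in the abelian group `Gal(K[m]/K)`. [cite: GrossLMS1991, §3 (p. 238: 𝒢_n abelian)]
[cite: Cox2013, §9.A] -/
theorem commute_of_zpowers_eq_ringClassGalOver (hK : IsImaginaryQuadratic K) (ι : K →+* ℂ) {m m₁ m₂ : ℕ}
    (hm : m ≠ 0) {σ₁ σ₂ : ringClassField K ι m ≃ₐ[ℚ] ringClassField K ι m}
    (h₁ : Subgroup.zpowers σ₁ = ringClassGalOver ι m m₁) (h₂ : Subgroup.zpowers σ₂ = ringClassGalOver ι m m₂) :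
    Commute σ₁ σ₂ := by
  have hm₁ : σ₁ ∈ ringClassGal ι m :=
    ringClassGalOver_le_ringClassGal ι m m₁ (h₁ ▸ Subgroup.mem_zpowers σ₁)
  have hm₂ : σ₂ ∈ ringClassGal ι m :=
    ringClassGalOver_le_ringClassGal ι m m₂ (h₂ ▸ Subgroup.mem_zpowers σ₂)
  exact commute_of_mem_ringClassGal hK hm hm₁ hm₂

/-- **`σ_q^{q+1} = 1`** for a generator `σ_q` of `G_q = Gal(K[m]/K[m/q])`, `q ∥ m`, `q` inert
(`#G_q = q + 1`). [cite: GrossLMS1991, §3 (3.3)] -/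
theorem pow_succ_eq_one_of_zpowers_eq_ringClassGalOver (hK : IsImaginaryQuadratic K) (ι : K →+* ℂ)
    {q m : ℕ} (hq : q.Prime) (hinert : (Ideal.span {(q : 𝓞 K)}).IsPrime) (hqm : q ∣ m)
    (hqm' : ¬ q ∣ m / q) (hm : m ≠ 0) (hunits : 2 ≤ m / q ∨ NumberField.discr K < -4)
    {σ : ringClassField K ι m ≃ₐ[ℚ] ringClassField K ι m}
    (hσ : Subgroup.zpowers σ = ringClassGalOver ι m (m / q)) : σ ^ (q + 1) = 1 := by
  rw [← orderOf_eq_succ_of_zpowers_eq_ringClassGalOver hK ι hq hinert hqm hqm' hm hunits hσ]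
  exact pow_orderOf_eq_one σ

/-- **(ES1) with `a_q(W₀) = 0` at a free level**: for `N = 9p(qm)` and a generator `σ` of
`Gal(K[N]/K[9pm])`, `Σ_{i ≤ q} σ^i y_{qm} = 0` on `W₀ = (y² + y = x³ − 1)` ((T10), the lower CM point
supplied here). [cite: GrossLMS1991, Prop. 3.7 (1)] [cite: HuShuYin2019, §4.1] -/
theorem sum_pointGalHom_pow_eq_zero_of_level {ω : K} (hω : ω ^ 2 + ω + 1 = 0)
    (h2 : Module.finrank ℚ K = 2) (ι : K →+* ℂ) [(⟨0, 0, 1, 0, -1⟩ : WeierstrassCurve ℚ).IsElliptic]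
    [(⟨0, 0, 1, 0, -1⟩ : WeierstrassCurve ℚ).IsGloballyMinimal]
    (Dt : ModularParametrizationData (⟨0, 0, 1, 0, -1⟩ : WeierstrassCurve ℚ) 243) {p q m N : ℕ} (hp : p % 3 = 1)
    (hN : 9 * p * (q * m) = N) (hq : q.Prime) (hq3 : q % 3 = 2) (hq2 : q ≠ 2) (hm : m ≠ 0)
    (hm3 : ∀ r ∈ m.primeFactors, r % 3 = 2) (hqm : ¬ q ∣ m) (hqp : ¬ q ∣ p)
    {σ : ringClassField K ι N ≃ₐ[ℚ] ringClassField K ι N}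
    (hσ : Subgroup.zpowers σ = ringClassGalOver ι N (9 * p * m))
    {y : ((⟨0, 0, 1, 0, -1⟩ : WeierstrassCurve ℚ).baseChange (ringClassField K ι N)).toAffine.Point}
    (hy : Affine.Point.map (W' := (⟨0, 0, 1, 0, -1⟩ : WeierstrassCurve ℚ)) (ringClassField K ι N).subtype.toRatAlgHom y =
      Dt.φ (heegnerTau (((q * m : ℕ) : ℤ) ^ 2 * (81 * ((p : ℤ) ^ 2 + 4 * p + 16)),
        ((q * m : ℕ) : ℤ) * (-(9 * (4 * (p : ℤ) ^ 2 + 17 * p + 72))), 4 * (p : ℤ) ^ 2 + 18 * p + 81))) :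
    ∑ i ∈ Finset.range (q + 1), pointGalHom (⟨0, 0, 1, 0, -1⟩ : WeierstrassCurve ℚ) (ringClassField K ι N) (σ ^ i) y = 0 := by
  subst hN
  haveI : Fact q.Prime := ⟨hq⟩
  have hK := JZero.isImaginaryQuadratic_of_sq_add_self_add_one hω h2
  have hdK := JZero.discr_eq_neg_three_of_sq_add_self_add_one hω h2
  have hq3' : q ≠ 3 := by rintro rfl; norm_num at hq3
  have hΔ := not_dvd_minimalDiscriminantInt_sylvesterNineMinimal hq hq3'
  have hp0 : p ≠ 0 := by rintro rfl; norm_num at hp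
  obtain ⟨y₀', hy₀'⟩ := exists_map_eq_phi_sylvesterTau_of_primeFactors hK hdK ι Dt hp hm hm3
  have hle : ringClassField K ι (9 * p * m) ≤ ringClassField K ι (9 * p * (q * m)) :=
    ringClassField_mono hK ι (mul_dvd_mul_left (9 * p) (Dvd.intro_left q rfl))
      (mul_ne_zero (mul_ne_zero (by norm_num) hp0) (mul_ne_zero hq.ne_zero hm))
  have hy₀ : Affine.Point.map (W' := (⟨0, 0, 1, 0, -1⟩ : WeierstrassCurve ℚ)) (ringClassField K ι (9 * p * (q * m))).subtype.toRatAlgHom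
      (Affine.Point.map (W' := (⟨0, 0, 1, 0, -1⟩ : WeierstrassCurve ℚ)) ((RingClassField.inclusion ι hle).restrictScalars ℚ) y₀') =
      Dt.φ (heegnerTau ((m : ℤ) ^ 2 * (81 * ((p : ℤ) ^ 2 + 4 * p + 16)),
        (m : ℤ) * (-(9 * (4 * (p : ℤ) ^ 2 + 17 * p + 72))), 4 * (p : ℤ) ^ 2 + 18 * p + 81)) := by
    rw [← hy₀']
    exact map_toRatAlgHom_map_inclusion (W := (⟨0, 0, 1, 0, -1⟩ : WeierstrassCurve ℚ)) ι hle
      (ringClassField K ι (9 * p * (q * m))).subtype (ringClassField K ι (9 * p * m)).subtype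
      (fun x' ↦ RingClassField.coe_inclusion ι hle x') y₀'
  exact sum_pointGalHom_pow_eq_zero_sylvesterTower hω h2 ι Dt hp hq3 hq2 hΔ hm hm3 hqm hqp hσ hy hy₀

/-- The derived point `D_l y` does not depend on the (subsingleton) equality instance on `L` used to add
points ((T16) is stated for `Classical.propDecidable`, the level files for the ambient instance). [folklore] -/
theorem foldr_derivOp_eq_of_decEq (W : WeierstrassCurve ℚ) {L : Type} [Field L] [CharZero L] (i₁ i₂ : DecidableEq L)
    (l : List ((L ≃ₐ[ℚ] L) × ℕ)) (y : (W.baseChange L).toAffine.Point) :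
    (letI := i₁; l.foldr (fun b z ↦ KolyvaginOperator.derivOp (pointGalHom W L) b.1 b.2 z) y) =
      (letI := i₂; l.foldr (fun b z ↦ KolyvaginOperator.derivOp (pointGalHom W L) b.1 b.2 z) y) := by
  obtain rfl := Subsingleton.elim i₁ i₂
  rfl

set_option maxHeartbeats 800000 in
/-- ★ **THE LEVEL DATA at a general square-free conductor `9p·n₀`** (RESIDUE c v3 (T-L1), class term; k-ty1
SPEC §5 (R2)–(R7) discharged at every level).  Inputs: the global data (`K ∋ ω` quadratic, `p ≡ 1 (3)` prime,
`Dt`; the frame transport `κ` (equivariant); the coupled frame `v_B, v_A, ψ_B, ψ_A, ρ` of `exists_coupledFrame`;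
the bottom embedding `emb₀ : K[9p] → K̄`, its fixer `N₀`, a transversal `t` of `Γ_K/N₀`) and the level data
(`n₀` square-free, `N = 9p·n₀`; a coherent `emb : K[N] → K̄` with point map `ιe` and fixer `N`; a list `l` of
`(σ_q, q)` over the prime factors `q` of `n₀` — each `q ≡ 2 (3)`, `q ≠ 2`, `⟨σ_q⟩ = G_q`, `2^M ∣ q+1` — covering
them; the CM point `y` over `φ(τ_{Q^{(n₀)}})`).  Output, for the derived point `D_l y` and `P := κ⁻¹ ιe(D_l y)`:
the `σ_q` commute and have `σ_q^{q+1} = 1`; (ES1) `Σ_{i≤q} σ_q^i y = 0`; `P ∈ E₉(K̄)^N`; (R5) every `h ∈ N₀`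
moves `P` by `2^M·E₉(K̄)^N`; `N ⊴ Γ_K`; `N₀` fixes `v_B, v_A`, `N` fixes `v_B`; `ψ_B(E₉(K̄)^N)`, `ψ_A(E₉(K̄)^N)`
are admissible at `2^M`; the χ-components `ψ_B(Σᵢ ρ_{tᵢ}(tᵢ•P))`, `ψ_A(Σᵢ ρ²_{tᵢ}(tᵢ•P))` lie in `invPoints`.
[cite: GrossLMS1991, §3 (3.3)–(3.7), §4 (4.1)–(4.3)] [cite: McCallumLMS1991, §4 (4)]
[cite: HuShuYin2019, §2 Prop. 2.4, §4.1] -/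
theorem levelData_sylvesterTower {ω : K} (hω : ω ^ 2 + ω + 1 = 0) (h2 : Module.finrank ℚ K = 2)
    (ι : K →+* ℂ) [(⟨0, 0, 1, 0, -1⟩ : WeierstrassCurve ℚ).IsElliptic] [(⟨0, 0, 1, 0, -1⟩ : WeierstrassCurve ℚ).IsGloballyMinimal]
    (Dt : ModularParametrizationData (⟨0, 0, 1, 0, -1⟩ : WeierstrassCurve ℚ) 243) {p : ℕ} (hp : p.Prime) (hp3 : p % 3 = 1)
    {n₀ N : ℕ} (hsq : Squarefree n₀) (hN : 9 * p * n₀ = N)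
    -- the frame transport `E₉(K̄) ≃+ W₀(K̄)`
    (κ : geomPoints ((cubeSumCurve 9).baseChange K) ≃+ geomPoints ((⟨0, 0, 1, 0, -1⟩ : WeierstrassCurve ℚ).baseChange K))
    (hκG : ∀ (g : absoluteGaloisGroup K) (P : geomPoints ((cubeSumCurve 9).baseChange K)), κ (g • P) = g • κ P)
    -- the coupled frame (`exists_coupledFrame`)
    {vB vA : AlgebraicClosure K} (hvBc : vB ^ 3 = algebraMap ℚ (AlgebraicClosure K) ((p : ℚ) / 9))
    (hvB : vB ≠ 0) (hvAc : vA ^ 3 = algebraMap ℚ (AlgebraicClosure K) ((p : ℚ) ^ 2 / 3)) (hvA0 : vA ≠ 0)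
    (hvB3 : ∀ g : absoluteGaloisGroup K, ((show AlgebraicClosure K ≃ₐ[K] AlgebraicClosure K from g) vB) ^ 3 = vB ^ 3)
    (hvA3 : ∀ g : absoluteGaloisGroup K, ((show AlgebraicClosure K ≃ₐ[K] AlgebraicClosure K from g) vA) ^ 3 = vA ^ 3)
    {ψB : geomPoints ((cubeSumCurve 9).baseChange K) ≃+ geomPoints ((cubeSumCurve (p : ℚ)).baseChange K)}
    {ψA : geomPoints ((cubeSumCurve 9).baseChange K) ≃+ geomPoints ((cubeSumCurve (3 * (p : ℚ) ^ 2)).baseChange K)}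
    {ρ : absoluteGaloisGroup K → geomPoints ((cubeSumCurve 9).baseChange K) ≃+ geomPoints ((cubeSumCurve 9).baseChange K)}
    (hρ : ∀ (g : absoluteGaloisGroup K) {x y : AlgebraicClosure K}
        (h : (((cubeSumCurve 9).baseChange K).baseChange (AlgebraicClosure K)).toAffine.Nonsingular x y),
        ∃ h', ρ g (Affine.Point.some x y h) =
          Affine.Point.some (((show AlgebraicClosure K ≃ₐ[K] AlgebraicClosure K from g) vB / vB) ^ 2 * x) y h')
    (hρρ : ∀ (g : absoluteGaloisGroup K) {x y : AlgebraicClosure K}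
        (h : (((cubeSumCurve 9).baseChange K).baseChange (AlgebraicClosure K)).toAffine.Nonsingular x y),
        ∃ h', ρ g (ρ g (Affine.Point.some x y h)) =
          Affine.Point.some (((show AlgebraicClosure K ≃ₐ[K] AlgebraicClosure K from g) vA / vA) ^ 2 * x) y h')
    (hlawB : ∀ (g : absoluteGaloisGroup K) (P : geomPoints ((cubeSumCurve 9).baseChange K)), g • ψB P = ψB (ρ g (g • P)))
    (hlawA : ∀ (g : absoluteGaloisGroup K) (P : geomPoints ((cubeSumCurve 9).baseChange K)),
        g • ψA P = ψA (ρ g (ρ g (g • P))))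
    -- the bottom embedding, its fixer, the transversal
    (emb₀ : ringClassField K ι (9 * p) →+* AlgebraicClosure K)
    (hemb₀ : ∀ k : K, emb₀ (algebraMap K (ringClassField K ι (9 * p)) k) = algebraMap K (AlgebraicClosure K) k)
    (N₀ : Subgroup (absoluteGaloisGroup K))
    (hN₀ : ∀ g : absoluteGaloisGroup K, g ∈ N₀ ↔
      ∀ x : ringClassField K ι (9 * p), (show AlgebraicClosure K ≃ₐ[K] AlgebraicClosure K from g) (emb₀ x) = emb₀ x)
    {ιt : Type} [Fintype ιt] (t : ιt → absoluteGaloisGroup K)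
    (ht : Function.Bijective fun i ↦ (t i : absoluteGaloisGroup K ⧸ N₀))
    -- the level `K[N]`: coherent embedding, point map, fixer
    (hle₀ : ringClassField K ι (9 * p) ≤ ringClassField K ι N)
    (emb : ringClassField K ι N →+* AlgebraicClosure K)
    (hemb : ∀ k : K, emb (algebraMap K (ringClassField K ι N) k) = algebraMap K (AlgebraicClosure K) k)
    (hcoh₀ : ∀ x : ringClassField K ι (9 * p), emb (RingClassField.inclusion ι hle₀ x) = emb₀ x)
    (ιe : letI : DecidableEq (ringClassField K ι N) := fun a b ↦ Classical.propDecidable (a = b)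
      ((⟨0, 0, 1, 0, -1⟩ : WeierstrassCurve ℚ).baseChange (ringClassField K ι N)).toAffine.Point →+ geomPoints ((⟨0, 0, 1, 0, -1⟩ : WeierstrassCurve ℚ).baseChange K))
    (hιe : ∀ P, ιe P = Affine.Point.map (W' := (⟨0, 0, 1, 0, -1⟩ : WeierstrassCurve ℚ)) emb.toRatAlgHom P)
    (Nf : Subgroup (absoluteGaloisGroup K))
    (hNf : ∀ g : absoluteGaloisGroup K, g ∈ Nf ↔
      ∀ x : ringClassField K ι N, (show AlgebraicClosure K ≃ₐ[K] AlgebraicClosure K from g) (emb x) = emb x)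
    -- the generators along the prime factors of `n₀`
    (l : List ((ringClassField K ι N ≃ₐ[ℚ] ringClassField K ι N) × ℕ))
    (hlmem : ∀ a ∈ l, a.2 ∈ n₀.primeFactors) (hcover : ∀ q ∈ n₀.primeFactors, ∃ a ∈ l, a.2 = q)
    (hl3 : ∀ a ∈ l, a.2 % 3 = 2) (hl2 : ∀ a ∈ l, a.2 ≠ 2)
    (hgen : ∀ a ∈ l, Subgroup.zpowers a.1 = ringClassGalOver ι N (N / a.2))
    {M : ℕ} (nl : ℕ) (hn : nl = 2 ^ M) (hdvd : ∀ a ∈ l, 2 ^ M ∣ a.2 + 1)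
    -- the CM point of conductor `9p·n₀`
    {y : ((⟨0, 0, 1, 0, -1⟩ : WeierstrassCurve ℚ).baseChange (ringClassField K ι N)).toAffine.Point}
    (hy : Affine.Point.map (W' := (⟨0, 0, 1, 0, -1⟩ : WeierstrassCurve ℚ)) (ringClassField K ι N).subtype.toRatAlgHom y =
      Dt.φ (heegnerTau ((n₀ : ℤ) ^ 2 * (81 * ((p : ℤ) ^ 2 + 4 * p + 16)),
        (n₀ : ℤ) * (-(9 * (4 * (p : ℤ) ^ 2 + 17 * p + 72))), 4 * (p : ℤ) ^ 2 + 18 * p + 81))) :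
    (∀ a ∈ l, ∀ b ∈ l, Commute a.1 b.1) ∧ (∀ a ∈ l, a.1 ^ (a.2 + 1) = 1) ∧
    (∀ a ∈ l, ∑ i ∈ Finset.range (a.2 + 1), pointGalHom (⟨0, 0, 1, 0, -1⟩ : WeierstrassCurve ℚ) (ringClassField K ι N) (a.1 ^ i) y = 0) ∧
    κ.symm (ιe (l.foldr (fun b z ↦ KolyvaginOperator.derivOp (pointGalHom (⟨0, 0, 1, 0, -1⟩ : WeierstrassCurve ℚ) (ringClassField K ι N)) b.1 b.2 z) y)) ∈
      FixedPoints.addSubgroup Nf (geomPoints ((cubeSumCurve 9).baseChange K)) ∧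
    (∀ h ∈ N₀, ∃ a ∈ FixedPoints.addSubgroup Nf (geomPoints ((cubeSumCurve 9).baseChange K)),
      ((nl : ℕ) : ℤ) • a =
        h • κ.symm (ιe (l.foldr (fun b z ↦ KolyvaginOperator.derivOp (pointGalHom (⟨0, 0, 1, 0, -1⟩ : WeierstrassCurve ℚ) (ringClassField K ι N)) b.1 b.2 z) y)) -
          κ.symm (ιe (l.foldr (fun b z ↦ KolyvaginOperator.derivOp (pointGalHom (⟨0, 0, 1, 0, -1⟩ : WeierstrassCurve ℚ) (ringClassField K ι N)) b.1 b.2 z) y))) ∧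
    Nf.Normal ∧
    (∀ h ∈ N₀, (show AlgebraicClosure K ≃ₐ[K] AlgebraicClosure K from h) vB = vB) ∧
    (∀ h ∈ N₀, (show AlgebraicClosure K ≃ₐ[K] AlgebraicClosure K from h) vA = vA) ∧
    (∀ h ∈ Nf, (show AlgebraicClosure K ≃ₐ[K] AlgebraicClosure K from h) vB = vB) ∧
    IsAdmissible (absoluteGaloisGroup K)
      ((FixedPoints.addSubgroup Nf (geomPoints ((cubeSumCurve 9).baseChange K))).map ψB.toAddMonoidHom) ((nl : ℕ) : ℤ) ∧
    IsAdmissible (absoluteGaloisGroup K)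
      ((FixedPoints.addSubgroup Nf (geomPoints ((cubeSumCurve 9).baseChange K))).map ψA.toAddMonoidHom) ((nl : ℕ) : ℤ) ∧
    ψB (∑ i, ρ (t i) (t i • κ.symm (ιe (l.foldr (fun b z ↦ KolyvaginOperator.derivOp (pointGalHom (⟨0, 0, 1, 0, -1⟩ : WeierstrassCurve ℚ) (ringClassField K ι N)) b.1 b.2 z) y)))) ∈
      invPoints (absoluteGaloisGroup K)
        ((FixedPoints.addSubgroup Nf (geomPoints ((cubeSumCurve 9).baseChange K))).map ψB.toAddMonoidHom) ((nl : ℕ) : ℤ) ∧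
    ψA (∑ i, ρ (t i) (ρ (t i) (t i • κ.symm (ιe (l.foldr (fun b z ↦ KolyvaginOperator.derivOp (pointGalHom (⟨0, 0, 1, 0, -1⟩ : WeierstrassCurve ℚ) (ringClassField K ι N)) b.1 b.2 z) y))))) ∈
      invPoints (absoluteGaloisGroup K)
        ((FixedPoints.addSubgroup Nf (geomPoints ((cubeSumCurve 9).baseChange K))).map ψA.toAddMonoidHom) ((nl : ℕ) : ℤ) := by
  subst hn
  have hK := JZero.isImaginaryQuadratic_of_sq_add_self_add_one hω h2
  have hp0 : p ≠ 0 := hp.ne_zero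
  have hp2 : p ≠ 2 := by rintro rfl; norm_num at hp3
  have hn₀ : n₀ ≠ 0 := hsq.ne_zero
  have h9p : 9 * p ≠ 0 := mul_ne_zero (by norm_num) hp0
  have hN0 : N ≠ 0 := by rw [← hN]; exact mul_ne_zero h9p hn₀
  -- every prime factor `q` of `n₀` is `≡ 2 (3)` and `≠ 2`
  have hq3 : ∀ q ∈ n₀.primeFactors, q % 3 = 2 := fun q hq ↦ by
    obtain ⟨a, ha, rfl⟩ := hcover q hq; exact hl3 a ha
  have hq2 : ∀ q ∈ n₀.primeFactors, q ≠ 2 := fun q hq ↦ by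
    obtain ⟨a, ha, rfl⟩ := hcover q hq; exact hl2 a ha
  have h3n₀ : ¬ 3 ∣ n₀ := fun h ↦ by
    have := hq3 3 (Nat.mem_primeFactors.mpr ⟨Nat.prime_three, h, hn₀⟩); omega
  have hpn₀ : ¬ p ∣ n₀ := fun h ↦ by
    have := hq3 p (Nat.mem_primeFactors.mpr ⟨hp, h, hn₀⟩); omega
  have h2n₀ : ¬ 2 ∣ n₀ := fun h ↦ hq2 2 (Nat.mem_primeFactors.mpr ⟨Nat.prime_two, h, hn₀⟩) rfl
  have hn₀odd : Odd n₀ := Nat.odd_iff.mpr (Nat.two_dvd_ne_zero.mp h2n₀)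
  have hpodd : Odd p := hp.eq_two_or_odd'.resolve_left hp2
  have hcop : Nat.Coprime n₀ (9 * p) := by
    refine Nat.Coprime.mul_right ?_ ?_
    · exact Nat.Coprime.pow_right 2 ((Nat.Prime.coprime_iff_not_dvd Nat.prime_three).mpr h3n₀).symm
    · exact ((Nat.Prime.coprime_iff_not_dvd hp).mpr hpn₀).symm
  -- the generators commute and have order dividing `q + 1`
  have hc : ∀ a ∈ l, ∀ b ∈ l, Commute a.1 b.1 := fun a ha b hb ↦
    commute_of_zpowers_eq_ringClassGalOver hK ι hN0 (hgen a ha) (hgen b hb)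
  have hord : ∀ a ∈ l, a.1 ^ (a.2 + 1) = 1 := by
    intro a ha
    have hq := hlmem a ha
    have hqp : a.2.Prime := Nat.prime_of_mem_primeFactors hq
    have hqn₀ : a.2 ∣ n₀ := Nat.dvd_of_mem_primeFactors hq
    have hinert := JZero.span_natCast_isPrime_of_mod_three_eq_two hω h2 hqp (hl3 a ha)
    have hqN : a.2 ∣ N := hN ▸ hqn₀.trans (Dvd.intro_left _ rfl)
    have hq9p : ¬ a.2 ∣ 9 * p := fun h ↦ by
      have := Nat.Coprime.eq_one_of_dvd (Nat.Coprime.coprime_dvd_left hqn₀ hcop) h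
      exact hqp.one_lt.ne' this
    have hdiv : N / a.2 = 9 * p * (n₀ / a.2) := by
      subst hN; exact Nat.mul_div_assoc _ hqn₀
    have hqN' : ¬ a.2 ∣ N / a.2 := by
      rw [hdiv]
      intro h
      rcases (Nat.Prime.dvd_mul hqp).mp h with h' | h'
      · exact hq9p h'
      · have : a.2 * a.2 ∣ n₀ := by
          have e := Nat.mul_div_cancel' hqn₀
          rw [← e]; exact Nat.mul_dvd_mul_left _ h'
        exact hqp.one_lt.ne' (Nat.isUnit_iff.mp (hsq _ this))
    have hunits : 2 ≤ N / a.2 ∨ NumberField.discr K < -4 := by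
      left; rw [hdiv]
      have : 1 ≤ p * (n₀ / a.2) := Nat.one_le_iff_ne_zero.mpr
        (mul_ne_zero hp0 (Nat.div_ne_zero_iff_of_dvd hqn₀ |>.mpr ⟨hn₀, hqp.ne_zero⟩))
      nlinarith
    exact pow_succ_eq_one_of_zpowers_eq_ringClassGalOver hK ι hqp hinert hqN hqN' hN0 hunits (hgen a ha)
  -- (ES1) along the list
  have htr : ∀ a ∈ l, ∑ i ∈ Finset.range (a.2 + 1),
      pointGalHom (⟨0, 0, 1, 0, -1⟩ : WeierstrassCurve ℚ) (ringClassField K ι N) (a.1 ^ i) y = 0 := by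
    intro a ha
    have hq := hlmem a ha
    have hqp : a.2.Prime := Nat.prime_of_mem_primeFactors hq
    have hqn₀ : a.2 ∣ n₀ := Nat.dvd_of_mem_primeFactors hq
    have e : n₀ = a.2 * (n₀ / a.2) := (Nat.mul_div_cancel' hqn₀).symm
    have hm : n₀ / a.2 ≠ 0 := (Nat.div_ne_zero_iff_of_dvd hqn₀).mpr ⟨hn₀, hqp.ne_zero⟩
    have hm3 : ∀ r ∈ (n₀ / a.2).primeFactors, r % 3 = 2 := fun r hr ↦
      hq3 r (Nat.primeFactors_mono (Nat.div_dvd_of_dvd hqn₀) hn₀ hr)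
    have hqm : ¬ a.2 ∣ n₀ / a.2 := fun h' ↦ by
      have : a.2 * a.2 ∣ n₀ := by rw [e]; exact Nat.mul_dvd_mul_left _ h'
      exact hqp.one_lt.ne' (Nat.isUnit_iff.mp (hsq _ this))
    have hqp' : ¬ a.2 ∣ p := fun h' ↦ by
      have := (Nat.prime_dvd_prime_iff_eq hqp hp).mp h'
      have h3 := hl3 a ha; rw [this] at h3; omega
    have hN' : 9 * p * (a.2 * (n₀ / a.2)) = N := by rw [← e]; exact hN
    have hdiv : N / a.2 = 9 * p * (n₀ / a.2) := by
      subst hN; exact Nat.mul_div_assoc _ hqn₀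
    have hσ : Subgroup.zpowers a.1 = ringClassGalOver ι N (9 * p * (n₀ / a.2)) := by
      rw [hgen a ha, hdiv]
    have hy' := hy
    rw [e] at hy'
    exact sum_pointGalHom_pow_eq_zero_of_level hω h2 ι Dt hp3 hN' hqp (hl3 a ha) (hl2 a ha) hm hm3 hqm hqp' hσ hy'
  -- the fixer `N₀` read at the level `N`
  have hN₀' := mem_iff_forall_mem_nine_mul ι hle₀ emb₀ emb hcoh₀ hN₀
  -- `P ∈ E₉(K̄)^N` and (R5)
  have hPN := mem_fixedPoints_symm_of_equivariant κ hκG Nf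
    (map_emb_mem_fixedPoints (⟨0, 0, 1, 0, -1⟩ : WeierstrassCurve ℚ) ι emb ιe hιe Nf hNf
      (l.foldr (fun b z ↦ KolyvaginOperator.derivOp (pointGalHom (⟨0, 0, 1, 0, -1⟩ : WeierstrassCurve ℚ) (ringClassField K ι N)) b.1 b.2 z) y))
  -- (T16) is stated for the `Classical.propDecidable` equality instance on `K[N]`; the sums and derivative
  -- operators here use the ambient instance — the two agree by `Subsingleton (DecidableEq _)`
  have hinst : (fun a b ↦ Classical.propDecidable (a = b) : DecidableEq (ringClassField K ι N)) =
      (inferInstance : DecidableEq (ringClassField K ι N)) := Subsingleton.elim _ _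
  have hP : ∀ h ∈ N₀, ∃ a ∈ FixedPoints.addSubgroup Nf (geomPoints ((cubeSumCurve 9).baseChange K)),
      ((2 ^ M : ℕ) : ℤ) • a =
        h • κ.symm (ιe (l.foldr (fun b z ↦ KolyvaginOperator.derivOp (pointGalHom (⟨0, 0, 1, 0, -1⟩ : WeierstrassCurve ℚ) (ringClassField K ι N)) b.1 b.2 z) y)) -
          κ.symm (ιe (l.foldr (fun b z ↦ KolyvaginOperator.derivOp (pointGalHom (⟨0, 0, 1, 0, -1⟩ : WeierstrassCurve ℚ) (ringClassField K ι N)) b.1 b.2 z) y)) := by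
    intro h hh
    have key := exists_fixedPoints_zsmul_eq_foldr_derivOp hK ι (⟨0, 0, 1, 0, -1⟩ : WeierstrassCurve ℚ) h9p hsq hcop
      hN emb hemb ιe hιe Nf hNf N₀ hN₀' l hcover hgen hc hord hdvd (by rw [hinst]; exact htr) hh
    rw [foldr_derivOp_eq_of_decEq (⟨0, 0, 1, 0, -1⟩ : WeierstrassCurve ℚ)
      (fun a b ↦ Classical.propDecidable (a = b)) inferInstance l y] at key
    exact exists_fixedPoints_zsmul_eq_symm_of_equivariant κ hκG Nf key
  -- the level package of the coupled frame
  subst hN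
  obtain ⟨hNn, -, hN₀vB, hN₀vA, hNvB, hAB, hAA, hP₁B, hP₁A⟩ := coupledFrame_levelPackage hω h2 ι hp0 hn₀
    hpodd hn₀odd hvBc hvB hvAc hvA0 hvB3 hvA3 hρ hρρ hlawB hlawA emb hemb Nf hNf N₀ hN₀' t ht M _ hPN hP
  exact ⟨hc, hord, htr, hPN, hP, hNn, hN₀vB, hN₀vA, hNvB, hAB, hAA, hP₁B, hP₁A⟩

end Summit.BirchSwinnertonDyer.BirchSwinnertonDyer.Theorems.SylvesterTwoCMFlip

end
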